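import Summits.BirchSwinnertonDyer.BirchSwinnertonDyer.Theorems.GoldfeldAllTwistsTwoConverseTwinGordTransport
import Summits.BirchSwinnertonDyer.BirchSwinnertonDyer.Theorems.GoldfeldK12AdditiveTwoBaseChange
import Literature.NumberTheory.QuadraticFields.FundamentalDiscriminant
import HarnessLib

set_option linter.dupNamespace false -- namespace `…BirchSwinnertonDyer.BirchSwinnertonDyer…` is the cell's (D-0017 nested layout)
set_option autoImplicit false

/-!
# Route `GoldfeldAllTwistsTwoConverse`, items 19350 / 19140 / 20044: the auxiliary field of the Gord-transport at `2` is
# NECESSARILY ramified at `2` — the relocated over-`K` input never sits at an unramified prime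

Cell `bsd-goldfeld`, seat `bsd-goldfeld-s1p-c3` gen 2 (prover). `--supports stmt-BirchSwinnertonDyer-19350`. Companion of the three
Gord-transport files (`…TwinGordTransport` p422635, `GoldfeldK12AdditiveTwoGordTransport` p425904, `…TwinGordPlacement` p427743).
Theorems only; no definition, axiom, `sorry`, instance, notation.

HONEST FRAMING — what this file is for. The transport relocates the additive cell of the formula twin (and of K12₂″) to the
`2`-part of BSD (resp. the rank-one `2`-converse) for ONE base change `W_K` to a quadratic field `K` in which the `d_K`-twist of
`W` is GOOD at `2`; the SUPPLY theorem produces such a `K` with `4 ∣ d_K`. This file proves the CONVERSE constraint: for EVERY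
quadratic `K` whose `d_K`-twist of an additive-cell curve `W` (`j = −3375`, bad at `2`) is good at `2`, necessarily `4 ∣ d_K` —
`2` RAMIFIES in `K`. So within this method the relocated input always lives at a prime of ramification index `2` (good ordinary
there), exactly the located gap of `Rank1Residual/Additive/GordDescent`; no variant of the transport reaches an UNRAMIFIED good
ordinary prime, where printed `p`-part technology over number fields lives (Wan 2015: `p` unramified in `F`). Mechanism: `W ≅ 49a1^{(D)}`,
`D` squarefree, `D ≢ 1 (mod 4)`; if `d_K` were odd (a fundamental discriminant `≡ 1 (mod 4)`, squarefree), the twist would be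
`49a1^{(n)}` with `n = D d_K/gcd² ≡ D ≢ 1 (mod 4)` squarefree, which is NOT good at `2` (Barrios–Roy–Sahajpal–Tallana–Tobin–Wiersema
2025 Thm. 5.1 rows `I₀`, tree theorem `not_hasGoodReductionAtPrime_two_of_smul_eq_quadraticTwist` of seat c201).

References: A. Barrios et al., arXiv:2501.03209 (2025) Thm. 5.1 [BarriosEtAl2025]; H. Cohen, *A Course in Computational Algebraic
Number Theory*, Def. 5.1.2 (fundamental discriminants) [Cohen1993]; X. Wan, Forum Math. Sigma 3 (2015) §1.1 [Wan2015Sigma];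
J. H. Silverman, *AEC* X.5 Cor. 5.4 [SilvermanAEC2009].
-/

noncomputable section

open scoped Classical

open WeierstrassCurve NumberField Literature.NumberTheory.EllipticCurves
  Literature.NumberTheory.QuadraticFields

namespace Summit.BirchSwinnertonDyer.BirchSwinnertonDyer.Theorems.GoldfeldGoodTwists

/-- **Twist algebra (general form).** If `C₁ • W = cm7^{(D)}` and `D · t = n · e²` with `e ≠ 0`, then `W^{(t)}` is
`ℚ`-isomorphic to `cm7^{(n)}`: `(cm7^{(D)})^{(t)} = cm7^{(Dt)} = cm7^{(n e²)} ≅ cm7^{(n)}`.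
[cite: SilvermanAEC2009, X.2 Prop. 2.4 and X.5 Cor. 5.4] -/
theorem exists_smul_twist_eq_cm7_twist_of_mul_eq (W : WeierstrassCurve ℚ) {D n : ℤ} {t e : ℚ}
    (C₁ : VariableChange ℚ) (hC : C₁ • W = cm7.quadraticTwist (D : ℚ)) (he : e ≠ 0)
    (hDt : (D : ℚ) * t = (n : ℚ) * e ^ 2) :
    ∃ C : VariableChange ℚ, C • W.quadraticTwist t = cm7.quadraticTwist (n : ℚ) := by
  have hW : W = C₁⁻¹ • cm7.quadraticTwist (D : ℚ) := by rw [← hC, inv_smul_smul]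
  obtain ⟨C₂, hC₂⟩ := cm7.exists_variableChange_quadraticTwist_mul_sq (n : ℚ) e he
  rw [hW, quadraticTwist_smul, quadraticTwist_quadraticTwist, hDt, ← hC₂, ← mul_smul]
  exact ⟨((⟨C₁⁻¹.u, t * C₁⁻¹.r, 0, 0⟩ : VariableChange ℚ) * C₂)⁻¹, inv_smul_smul _ _⟩

/-- The square of an odd integer is `≡ 1 (mod 4)`. [folklore] -/
theorem sq_emod_four_eq_one_of_odd {g : ℤ} (hg : ¬ (2 : ℤ) ∣ g) : g ^ 2 % 4 = 1 := by
  have h : g % 4 = 1 ∨ g % 4 = 3 := by omega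
  rw [pow_two, Int.mul_emod]
  rcases h with h | h <;> rw [h] <;> norm_num

/-- **NECESSITY OF RAMIFICATION.** Let `W/ℚ` be globally minimal with `j = −3375` and bad (additive) reduction at `2`, `K` a
quadratic field, and `Wd` an elliptic `ℚ`-model of the twist `W^{(d_K)}` with GOOD reduction at `2`. Then `4 ∣ d_K`: the prime `2`
RAMIFIES in `K`. (If `d_K` were a fundamental discriminant `≡ 1 (mod 4)` — squarefree, tree `isFundamentalDiscriminant_discr` — then
`Wd ≅ 49a1^{(n)}` with `n = D·d_K/gcd(D,d_K)²` squarefree and `n ≡ D ≢ 1 (mod 4)`, hence `n ≡ 2, 3 (mod 4)`, and such a twist of the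
good curve `49a1` is not good at `2` by Barrios et al. 2025.) [cite: BarriosEtAl2025, Thm. 5.1 with the rows R = I₀ of the §5 tables]
[cite: Cohen1993, Def. 5.1.2] -/
theorem four_dvd_discr_of_model_twist_goodTwo (W : WeierstrassCurve ℚ) [W.IsElliptic] [W.IsGloballyMinimal]
    (hj : W.j = -3375) (hg : ¬ W.HasGoodReductionAtPrime 2) (K : Type) [Field K] [NumberField K]
    (h2 : Module.finrank ℚ K = 2) (Wd : WeierstrassCurve ℚ) [Wd.IsElliptic]
    (hWd : ∃ C : VariableChange ℚ, C • W.quadraticTwist (NumberField.discr K : ℚ) = Wd)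
    (hgd : Wd.HasGoodReductionAtPrime 2) : 4 ∣ NumberField.discr K := by
  rcases Quadratic.isFundamentalDiscriminant_discr (K := K) h2 with ⟨h1, hsq, -⟩ | ⟨h4, -, -⟩
  swap
  · exact h4
  exfalso
  obtain ⟨D, hD0, hDsq, hD4, C₁, hC₁⟩ := exists_squarefree_twist_of_j_neg3375_of_not_good_two W hj hg
  set t : ℤ := NumberField.discr K with ht_def
  have ht0 : t ≠ 0 := NumberField.discr_ne_zero K
  -- write `D = D' g`, `t = t' g` with `gcd(D', t') = 1`
  have hgpos : 0 < Int.gcd D t := Int.gcd_pos_of_ne_zero_left t hD0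
  obtain ⟨g, D', t', hg0, hcop, hD, ht⟩ := Int.exists_gcd_one' hgpos
  set n : ℤ := D' * t' with hn_def
  -- `n` is squarefree
  have hD'sq : Squarefree D' := hDsq.squarefree_of_dvd ⟨g, by rw [hD]⟩
  have ht'sq : Squarefree t' := hsq.squarefree_of_dvd ⟨g, by rw [ht]⟩
  have hnsq : Squarefree n :=
    squarefree_mul_iff.mpr ⟨(Int.isCoprime_iff_gcd_eq_one.mpr hcop).isRelPrime, hD'sq, ht'sq⟩
  -- `n ≡ D (mod 4)`, hence `n ≡ 2, 3 (mod 4)`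
  have hgodd : ¬ (2 : ℤ) ∣ (g : ℤ) := by
    rintro ⟨k, hk⟩
    have : (2 : ℤ) ∣ t := ⟨t' * k, by rw [ht, hk]; ring⟩
    omega
  have hDt : D * t = n * (g : ℤ) ^ 2 := by rw [hD, ht, hn_def]; ring
  have hn4 : n % 4 = 2 ∨ n % 4 = 3 := by
    have h1' : (D * t) % 4 = D % 4 := by
      rw [Int.mul_emod, h1, mul_one, Int.emod_emod_of_dvd _ (dvd_refl _)]
    have h2' : (D * t) % 4 = n % 4 := by
      rw [hDt, Int.mul_emod, sq_emod_four_eq_one_of_odd hgodd, mul_one, Int.emod_emod_of_dvd _ (dvd_refl _)]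
    have hD40 : D % 4 ≠ 0 := by
      intro h0
      have h22 : (2 : ℤ) * 2 ∣ D := by
        simpa [show (2 : ℤ) * 2 = 4 by norm_num] using Int.dvd_of_emod_eq_zero h0
      rcases Int.isUnit_iff.mp (hDsq 2 h22) with h | h <;> norm_num at h
    omega
  -- `Wd ≅ cm7^{(n)}`
  have hg0' : ((g : ℤ) : ℚ) ≠ 0 := by exact_mod_cast Nat.pos_iff_ne_zero.mp hg0
  have hDt' : (D : ℚ) * (t : ℚ) = (n : ℚ) * ((g : ℤ) : ℚ) ^ 2 := by exact_mod_cast hDt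
  obtain ⟨C₂, hC₂⟩ := exists_smul_twist_eq_cm7_twist_of_mul_eq W C₁ hC₁ hg0' hDt'
  obtain ⟨C, rfl⟩ := hWd
  have hWdn : (C₂ * C⁻¹) • (C • W.quadraticTwist (t : ℚ)) = cm7.quadraticTwist (n : ℚ) := by
    rw [mul_smul, inv_smul_smul, hC₂]
  exact not_hasGoodReductionAtPrime_two_of_smul_eq_quadraticTwist cm7 _ hasGoodReductionAtPrime_cm7_two hn4 hWdn hgd

/-- **The auxiliary field of the transport is never unramified at `2`** (corollary, in the shape used by the transport files):
for `W` of the `j = −3375` additive cell there is NO quadratic field `K` with ODD discriminant admitting a good-at-`2` globally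
minimal model of the `d_K`-twist. [cite: BarriosEtAl2025, Thm. 5.1 with the rows R = I₀ of the §5 tables] -/
theorem not_exists_oddDiscr_twistField_goodTwo (W : WeierstrassCurve ℚ) [W.IsElliptic] [W.IsGloballyMinimal]
    (hj : W.j = -3375) (hg : ¬ W.HasGoodReductionAtPrime 2) :
    ¬ ∃ (K : Type) (_ : Field K) (_ : NumberField K), Module.finrank ℚ K = 2 ∧ ¬ (2 : ℤ) ∣ NumberField.discr K ∧
      ∃ (Wd : WeierstrassCurve ℚ) (_ : Wd.IsElliptic) (_ : Wd.IsGloballyMinimal),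
        (∃ C : VariableChange ℚ, C • W.quadraticTwist (NumberField.discr K : ℚ) = Wd) ∧ Wd.HasGoodReductionAtPrime 2 := by
  rintro ⟨K, iF, iN, h2, hodd, Wd, iWd, -, hWd, hgd⟩
  have h4 := four_dvd_discr_of_model_twist_goodTwo W hj hg K h2 Wd hWd hgd
  exact hodd (dvd_trans ⟨2, by norm_num⟩ h4)

end Summit.BirchSwinnertonDyer.BirchSwinnertonDyer.Theorems.GoldfeldGoodTwists

end
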